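import Summits.BirchSwinnertonDyer.BirchSwinnertonDyer.Theorems.ManinLocalTwoThreeManinOddAtFourKernelSplit
import Summits.BirchSwinnertonDyer.BirchSwinnertonDyer.Theorems.ManinLocalTwoThreeShimuraKernelBlindNecessary
import Summits.BirchSwinnertonDyer.BirchSwinnertonDyer.Theorems.ManinLocalTwoThreeGammaOneIndexFour
import HarnessLib

/-!
# C2 — THE TRANSFER SPLIT: on the gain locus ONE row, E-an-151|_G «|c₀| = |c₁|» (no doubling of the Manin constant under the Shimura cover), replaces BOTH kernel
# rows of v27 (index ≠ 4, blind kernel root) — they follow from it by tree theorems; C2 ⟸ print ∧ CDT ∧ {E-an-151|_G, 6♭‴|_G}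
(route `ManinLocalTwoThree`, deciding crux C2 `ManinOddAtFour` stmt-BirchSwinnertonDyer-22967; cell bsd-f2-manin, prover p3 gen 18; a v28-candidate composition;
`--supports stmt-BirchSwinnertonDyer-22967`; sequel to `…ManinOddAtFourKernelSplit` (p748595); engines: the LEAD's `shimuraKernelBlindAt_of_natAbs_eq`
(`…ShimuraKernelBlindNecessary`, p713937: no doubling ∧ `Λ₁ ≠ Λ₀` ⟹ the kernel generator is a BLIND rational root) and `natAbs_maninConstant₀_eq_two_mul_of_index_four`
(`…GammaOneIndexFour`: index `4` ⟹ doubling), p2's AN2₂, the LEAD's `FullTwoTorsion.*`)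

WHY.  LEAD-MEMO v37 §3: by the C2-ledger `not_two_dvd_maninConstant₀_iff_of_four_dvd_level`, C2 on a class = «no doubling» ∧ «c₁ odd».  v27 fed the gain locus G with two rows
(I4 = E-an-152b|_G and K♭ = E-an-152♭|_G); both are CONSEQUENCES of the single classical row **E-an-151|_G: `|c₀| = |c₁|` for the optimal `X₁(N)`/`X₀(N)` pair of a gain class**
(index `4` forces `|c₀| = 2|c₁|`; no doubling at index `2` forces a blind kernel root).  So:
* §1 `not_two_dvd_maninConstant_of_transferLawG_core` — the datum-level composition: irreducible by F♯; `Λ₁ = Λ₀` by `hEven` (UDC₂ ∧ CDT); on G: the optimal `X₁`-datum `D₁` (CES),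
  `|c₀| = |c₁|` (row E-an-151|_G) ⟹ ¬ index 4 ⟹ a blind rational root `E` (p713937) ⟹ EITHER a second rational root (⟹ index 4 by UDC₂ twice, `hTwoRoots`; contradiction) OR total
  blindness ⟹ the v23 blind road with 6♭‴|_G (Kato–Néron at `E₁` ⟹ `2 ∤ c₁` ⟹ `2 ∤ c₀`).
* §2 the `16 ∣ N` core form `maninOddAtSixteenCore_of_v28` and the route decl from abstract inputs `maninOddAtFour_of_katoFact_udcTwo_transferLawG`;
* §3 the instantiations **`maninOddAtFour_of_katoFact_CDT_transferLawG`** (route decl BY NAME from F♯, F★, F♮, CES, F-es-21♭K, CDT-algInt and the OPEN rows E-an-151|_G (inline) and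
  6♭‴|_G) and **`maninOddAtFour_of_katoFact_CDT_transferRow`** (the same from -an's NAMED row `ShimuraKernel.GammaOneTransferAtFour` = E-an-151).
NECESSITY (tree, by name): E-an-151 ⟸ C2 (`ShimuraKernel.gammaOneTransferAtFour_of_body`); 6♭‴ ⟹ «c₁ odd» ⟸ C2 (ledger).  v28 stubs = 3 printed + E-an-151|_G + 6♭‴|_G (5).
HONEST FRAMING.  CONDITIONAL reduction; E-an-151 and 6♭‴ are OPEN cell rows (E-an-151|_{G₁} IS «no doubling», i.e. half of C2 on one-root gain classes, LEAD v37 §3); CDT and the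
cusp/Kato facts are printed, not proved in the tree; C2, Manin's conjecture and BSD are NOT proved.  No definitions, no sorry.
[cite: Kato2004Asterisque, Thm. 12.5 (1) (p. 221)] [cite: ConradEdixhovenStein2003, §6.1.2 and §6.2] [cite: Stevens1982, Thm. 1.3.1] [cite: Stevens1989, §2]
[cite: KurthLong2008, Prop. 18] [cite: CalegariDimitrovTang2025, Thm. 1.0.1 and Remarks 58–59] [cite: CesnaviciusNeururerSaha2023, Lemma 6.5]
-/

set_option autoImplicit false
-- lint-debt: the directory name repeats the summit name (sibling precedent `ManinLocalTwoThreeManinOddAtFourKernelSplit.lean`)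
set_option linter.dupNamespace false

noncomputable section

open scoped Classical MatrixGroups ModularForm NumberField PeriodPair Manifold
open PowerSeries CongruenceSubgroup IsDedekindDomain IsDedekindDomain.HeightOneSpectrum Rat.HeightOneSpectrum
open WeierstrassCurve Literature.NumberTheory.DiophantineGeometry Literature.NumberTheory.EllipticCurves
  Literature.NumberTheory.EllipticCurves.ModularForms Literature.RingTheory.FormalGroups
open Summit.BirchSwinnertonDyer.Rank1Residual.ManinAdditive
open Summit.BirchSwinnertonDyer.Rank1Residual.ManinAdditive.CuspidalKummer
open Summit.BirchSwinnertonDyer.Rank1Residual.ManinAdditive.ShimuraLedger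
open Summit.BirchSwinnertonDyer.Rank1Residual.ManinAdditive.KatoCurve
open Summit.BirchSwinnertonDyer.Rank1Residual.ManinAdditive.ShimuraKernel
open Summit.BirchSwinnertonDyer.BirchSwinnertonDyer.Theorems.ManinLocalTwoThree.SigmaSquareRoot
open Summit.BirchSwinnertonDyer.BirchSwinnertonDyer.Theorems.ManinLocalTwoThree.SigmaHabitat
open Summit.BirchSwinnertonDyer.BirchSwinnertonDyer.Theorems.ManinLocalTwoThree.KernelSplit
open Summit.BirchSwinnertonDyer.Rank1Residual.ManinAdditive.UDCKummerLineK

namespace Summit.BirchSwinnertonDyer.BirchSwinnertonDyer.Theorems.ManinLocalTwoThree.TransferSplit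

/-! ## §1 The datum-level composition with the transfer split -/

/-- **C2 LEVEL-WISE on the core, TRANSFER split** (`4 ∣ N`): irreducible `W[2]` by F♯; `Λ₁(f) = Λ₀(f)` by `hEven`; on the gain locus the optimal `X₁(N)`-datum (CES) and the row
E-an-151|_G (`|c₀| = |c₁|`) exclude index `4` (`natAbs_maninConstant₀_eq_two_mul_of_index_four`) and give a blind rational root (`shimuraKernelBlindAt_of_natAbs_eq`); then a second
rational root contradicts `2 ∣ c` (`hTwoRootsN`), and total blindness runs the blind road with `hKatoN`.  CONDITIONAL reduction; nothing about BSD or Manin's conjecture is proved.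
[cite: Stevens1989, §2] [cite: Kato2004Asterisque, Thm. 12.5 (1) (p. 221)] [cite: ConradEdixhovenStein2003, §6.1.2] -/
theorem not_two_dvd_maninConstant_of_transferLawG_core
    (hF : kato_neron_isIntegral_twistedSymbolSum_of_additive_two_real)
    (hFstar : optimalGamma1Parametrization_cusp_rational) (hFnat : optimalGamma1Parametrization_cuspZero_galoisConjugate)
    (hex : exists_optimal_gamma1ParametrizationData)
    {N : ℕ} [NeZero N] (h4 : 2 ^ 2 ∣ N)
    (hEven : ∀ (V : WeierstrassCurve ℚ) [V.IsElliptic] [V.IsGloballyMinimal] (D : ModularParametrizationData V N),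
      (∀ z ∈ D.L.lattice, ∃ w ∈ periodLattice D.f, z = D.c * w) →
      ∀ e : ℚ, V.twoTorsionPolynomial.toPoly.IsRoot e → (2 : ℤ) ∣ D.c → periodLatticeGamma1 D.f ≠ periodLattice D.f)
    (hTwoRootsN : ∀ (V : WeierstrassCurve ℚ) [V.IsElliptic] [V.IsGloballyMinimal] (D : ModularParametrizationData V N),
      (∀ z ∈ D.L.lattice, ∃ w ∈ periodLattice D.f, z = D.c * w) →
      ∀ e e' : ℚ, V.twoTorsionPolynomial.toPoly.IsRoot e → V.twoTorsionPolynomial.toPoly.IsRoot e' → e ≠ e' →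
      ¬ (∀ z : ℂ, z ∈ periodLatticeGamma1 D.f ↔ ∃ w ∈ periodLattice D.f, z = 2 * w) → ¬ (2 : ℤ) ∣ D.maninConstant)
    (h151N : ∀ (V₁ V : WeierstrassCurve ℚ) [V₁.IsElliptic] [V₁.IsGloballyMinimal] [V.IsElliptic] [V.IsGloballyMinimal]
      (D₁ : Gamma1ParametrizationData V₁ N) (D : ModularParametrizationData V N), IsIsogenous V₁ V → D₁.IsOptimal →
      (∀ z ∈ D.L.lattice, ∃ w ∈ periodLattice D.f, z = D.c * w) →
      ((primesEquiv (R := 𝓞 ℚ)).symm ⟨2, Nat.prime_two⟩).valuation ℚ V.j < 1 → (∀ d : ℤ, d = -1 ∨ d = 2 ∨ d = -2 → 2 ≤ (V.quadraticTwist (d : ℚ)).conductorExponent ((primesEquiv (R := ℤ)).symm ⟨2, Nat.prime_two⟩)) →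
      modularSymbol D.f 0 ∉ periodLattice D.f → periodLatticeGamma1 D.f ≠ periodLattice D.f → V.a₁ = 0 → V.a₃ = 0 →
      D.maninConstant.natAbs = D₁.maninConstant.natAbs)
    (hKatoN : ∀ (V : WeierstrassCurve ℚ) [V.IsElliptic] [V.IsGloballyMinimal] (D₁ : Gamma1ParametrizationData V N),
      D₁.IsOptimal → (∃ (W₀ : WeierstrassCurve ℚ) (_ : W₀.IsElliptic) (_ : W₀.IsGloballyMinimal) (D₀ : ModularParametrizationData W₀ N),
        IsIsogenous V W₀ ∧ (∀ z ∈ D₀.L.lattice, ∃ w ∈ periodLattice D₀.f, z = D₀.c * w) ∧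
        W₀.a₁ = 0 ∧ W₀.a₃ = 0 ∧ HasRationalTwoTorsion W₀ ∧ AllRationalTwoTorsionBlind W₀ ∧
        ((primesEquiv (R := 𝓞 ℚ)).symm ⟨2, Nat.prime_two⟩).valuation ℚ W₀.j < 1 ∧
        (∀ d : ℤ, d = -1 ∨ d = 2 ∨ d = -2 → 2 ≤ (W₀.quadraticTwist (d : ℚ)).conductorExponent ((primesEquiv (R := ℤ)).symm ⟨2, Nat.prime_two⟩)) ∧
        modularSymbol D₀.f 0 ∉ periodLattice D₀.f ∧ periodLatticeGamma1 D₀.f ≠ periodLattice D₀.f) → KatoFactTwoAt V D₁.f)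
    (W : WeierstrassCurve ℚ) [W.IsElliptic] [W.IsGloballyMinimal] (D : ModularParametrizationData W N)
    (hopt : ∀ z ∈ D.L.lattice, ∃ w ∈ periodLattice D.f, z = D.c * w)
    (hss : ((primesEquiv (R := 𝓞 ℚ)).symm ⟨2, Nat.prime_two⟩).valuation ℚ W.j < 1) (hcore : (∀ d : ℤ, d = -1 ∨ d = 2 ∨ d = -2 → 2 ≤ (W.quadraticTwist (d : ℚ)).conductorExponent ((primesEquiv (R := ℤ)).symm ⟨2, Nat.prime_two⟩))) :
    ¬ (2 : ℤ) ∣ D.maninConstant := by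
  by_cases hirr : W.HasIrreducibleModPGaloisRep 2
  · exact katoManinOddTwo_of_real_of_exists_gamma1 hF hex W D hopt h4 hirr
  have h4' : 4 ∣ N := by norm_num at h4; exact h4
  obtain ⟨h2, hN2⟩ := lFunction_two_eq_zero_of_four_dvd W D.isNewformOf h4'
  have hadd := hasAdditiveReductionAt_two_of_lFunction_two_eq_zero W h2 hN2
  obtain ⟨C, M, hu, hCW, hM1, hM3, hmin⟩ := exists_smul_eq_map_a₁_a₃_eq_zero_of_hasAdditiveReductionAt_two W hadd
  haveI := hmin
  obtain ⟨D', hf, hc, hL, -⟩ := exists_modularParametrizationData_smul_of_u_eq_one W D C hu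
  have hopt' : ∀ z ∈ D'.L.lattice, ∃ w ∈ periodLattice D'.f, z = D'.c * w := by
    rw [hL, hf, hc]; exact hopt
  have ha₁ : (C • W).a₁ = 0 := by rw [hCW, map_a₁, hM1, map_zero]
  have ha₃ : (C • W).a₃ = 0 := by rw [hCW, map_a₃, hM3, map_zero]
  have hssC : ((primesEquiv (R := 𝓞 ℚ)).symm ⟨2, Nat.prime_two⟩).valuation ℚ (C • W).j < 1 := by
    rw [variableChange_j]; exact hss
  have hcoreC := twistCore_smul W C hcore
  suffices h : ¬ (2 : ℤ) ∣ D'.maninConstant by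
    change ¬ (2 : ℤ) ∣ D'.c at h
    change ¬ (2 : ℤ) ∣ D.c
    rwa [hc] at h
  have hred' : ¬ (C • W).HasIrreducibleModPGaloisRep 2 := by
    rwa [Mazur1978.hasIrreducibleModPGaloisRep_smul_iff]
  by_cases hΛ : periodLatticeGamma1 D'.f = periodLattice D'.f
  · -- STEVENS' CURVE = THE OPTIMAL CURVE (`Λ₁ = Λ₀`): an even `c` would force `Λ₁ ≠ Λ₀`
    obtain ⟨e, he⟩ := exists_isRoot_twoTorsionPolynomial_of_not_hasIrreducibleModPGaloisRep_two (C • W) hred'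
    exact fun h2 ↦ hEven (C • W) D' hopt' e he h2 hΛ
  · -- THE GAIN LOCUS `Λ₁ ≠ Λ₀`
    have h0 : modularSymbol D'.f 0 ∉ periodLattice D'.f := modularSymbol_zero_not_mem_of_ne_of_print hFstar hFnat hex D' hopt' hΛ
    intro h2
    -- the optimal `X₁(N)`-datum and the row E-an-151|_G: no doubling
    obtain ⟨W₁, i₁, i₂, D₁, hiso, hD₁⟩ := hex (C • W) D' hopt'
    have hf₁ : D₁.f = D'.f := D₁.f_eq_of_isIsogenous D' hiso
    have heq := h151N W₁ (C • W) D₁ D' hiso hD₁ hopt' hssC hcoreC h0 hΛ ha₁ ha₃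
    -- index 4 would double the constant
    have hidx : ¬ (∀ z : ℂ, z ∈ periodLatticeGamma1 D'.f ↔ ∃ w ∈ periodLattice D'.f, z = 2 * w) := by
      intro hidx4
      have hd := natAbs_maninConstant₀_eq_two_mul_of_index_four D₁ D' hD₁ hopt' (fun z ↦ by rw [hf₁]; exact hidx4 z)
      have hne : D₁.maninConstant.natAbs ≠ 0 := Int.natAbs_ne_zero.mpr D₁.maninConstant_ne_zero
      omega
    -- the kernel generator is a BLIND rational root (LEAD's converse Vélu step)
    obtain ⟨w, hw, hw2⟩ := exists_mem_periodLatticeGamma1_ne_two_mul_of_not_indexFour D' h4 hidx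
    obtain ⟨A₂, A₄, E, hA₂, hA₄, hE, -, hbl⟩ := shimuraKernelBlindAt_of_natAbs_eq D₁ D' hiso hD₁ hopt' h4 ha₁ ha₃ heq hΛ hw hw2
    have hErt : (C • W).twoTorsionPolynomial.toPoly.IsRoot (E : ℚ) := (isRoot_twoTorsionPolynomial_iff_of_a₁_a₃ (C • W) ha₁ ha₃ _).mpr hE
    by_cases hsec : ∃ e : ℚ, (C • W).twoTorsionPolynomial.toPoly.IsRoot e ∧ e ≠ (E : ℚ)
    · -- a SECOND rational root: UDC₂ twice forces index 4
      obtain ⟨e, he, hne⟩ := hsec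
      exact hTwoRootsN (C • W) D' hopt' e E he hErt hne hidx h2
    · -- `E` is the only rational root: the curve is totally blind — the blind road with 6♭‴|_G
      push Not at hsec
      have hall : AllRationalTwoTorsionBlind (C • W) := fun e he ↦
        ⟨A₂, A₄, E, hA₂, hA₄, (hsec e ((isRoot_twoTorsionPolynomial_iff_of_a₁_a₃ (C • W) ha₁ ha₃ e).mpr he)).symm, hbl⟩
      have hT : HasRationalTwoTorsion (C • W) := ⟨E, hE⟩
      have hKato : KatoFactTwoAt W₁ D₁.f :=
        hKatoN W₁ D₁ hD₁ ⟨C • W, inferInstance, hmin, D', hiso, hopt', ha₁, ha₃, hT, hall, hssC, hcoreC, h0, hΛ⟩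
      exact not_two_dvd_maninConstant_of_katoFactAt₁_of_allBlind hFstar W₁ (C • W) D₁ D' hiso hD₁ hopt' h4 ha₁ ha₃ hall hKato h2

/-! ## §2 The `16 ∣ N` core form and the route decl from abstract inputs -/

/-- **C2 on the core ∩ {`16 ∣ N`} ⟸ F♯ ∧ F★ ∧ F♮ ∧ CES ∧ F-es-21♭K ∧ `hEven` ∧ `hTwoRoots` ∧ E-an-151|_G ∧ 6♭‴|_G** (§1 + the period-recut dispatcher, as in v25–v27).
CONDITIONAL. [cite: Kato2004Asterisque, Thm. 12.5 (1) (p. 221)] [cite: Stevens1989, §2] -/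
theorem maninOddAtSixteenCore_of_v28
    (hF : kato_neron_isIntegral_twistedSymbolSum_of_additive_two_real)
    (hFstar : optimalGamma1Parametrization_cusp_rational) (hFnat : optimalGamma1Parametrization_cuspZero_galoisConjugate)
    (hex : exists_optimal_gamma1ParametrizationData) (hK : kato_isIntegral_twistedSymbolSum_two_symbolClosure)
    (hEven : ∀ (W : WeierstrassCurve ℚ) [W.IsElliptic] [W.IsGloballyMinimal] {N : ℕ} [NeZero N] (D : ModularParametrizationData W N),
      2 ^ 4 ∣ N → (∀ z ∈ D.L.lattice, ∃ w ∈ periodLattice D.f, z = D.c * w) →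
      ∀ e : ℚ, W.twoTorsionPolynomial.toPoly.IsRoot e → (2 : ℤ) ∣ D.c → periodLatticeGamma1 D.f ≠ periodLattice D.f)
    (hTwoRoots : ∀ (W : WeierstrassCurve ℚ) [W.IsElliptic] [W.IsGloballyMinimal] {N : ℕ} [NeZero N] (D : ModularParametrizationData W N),
      2 ^ 4 ∣ N → (∀ z ∈ D.L.lattice, ∃ w ∈ periodLattice D.f, z = D.c * w) →
      ∀ e e' : ℚ, W.twoTorsionPolynomial.toPoly.IsRoot e → W.twoTorsionPolynomial.toPoly.IsRoot e' → e ≠ e' →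
      ¬ (∀ z : ℂ, z ∈ periodLatticeGamma1 D.f ↔ ∃ w ∈ periodLattice D.f, z = 2 * w) → ¬ (2 : ℤ) ∣ D.maninConstant)
    (h151 : ∀ (W₁ W : WeierstrassCurve ℚ) [W₁.IsElliptic] [W₁.IsGloballyMinimal] [W.IsElliptic] [W.IsGloballyMinimal] {N : ℕ} [NeZero N]
      (D₁ : Gamma1ParametrizationData W₁ N) (D : ModularParametrizationData W N), IsIsogenous W₁ W → D₁.IsOptimal →
      2 ^ 4 ∣ N → (∀ z ∈ D.L.lattice, ∃ w ∈ periodLattice D.f, z = D.c * w) →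
      ((primesEquiv (R := 𝓞 ℚ)).symm ⟨2, Nat.prime_two⟩).valuation ℚ W.j < 1 →
      (∀ d : ℤ, d = -1 ∨ d = 2 ∨ d = -2 → 2 ≤ (W.quadraticTwist (d : ℚ)).conductorExponent ((primesEquiv (R := ℤ)).symm ⟨2, Nat.prime_two⟩)) →
      modularSymbol D.f 0 ∉ periodLattice D.f → periodLatticeGamma1 D.f ≠ periodLattice D.f → W.a₁ = 0 → W.a₃ = 0 →
      D.maninConstant.natAbs = D₁.maninConstant.natAbs)
    (h110 : ∀ (V : WeierstrassCurve ℚ) [V.IsElliptic] [V.IsGloballyMinimal] {N : ℕ} [NeZero N]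
      (D₁ : Gamma1ParametrizationData V N), D₁.IsOptimal → 2 ^ 4 ∣ N →
      (¬ ∃ (V' : WeierstrassCurve ℚ) (_ : V'.IsElliptic) (_ : V'.IsGloballyMinimal) (q m : ℤ),
        Odd q ∧ WeierstrassCurve.IsIsogenous V' V ∧ (q : ℝ) * V'.realPeriodRat = (m : ℝ) * V.realPeriodRat ∧
        IsSymbolClosureCurve V' D₁.f) →
      (∃ (W₀ : WeierstrassCurve ℚ) (_ : W₀.IsElliptic) (_ : W₀.IsGloballyMinimal) (D₀ : ModularParametrizationData W₀ N),
        IsIsogenous V W₀ ∧ (∀ z ∈ D₀.L.lattice, ∃ w ∈ periodLattice D₀.f, z = D₀.c * w) ∧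
        W₀.a₁ = 0 ∧ W₀.a₃ = 0 ∧ HasRationalTwoTorsion W₀ ∧ AllRationalTwoTorsionBlind W₀ ∧
        ((primesEquiv (R := 𝓞 ℚ)).symm ⟨2, Nat.prime_two⟩).valuation ℚ W₀.j < 1 ∧
        (∀ d : ℤ, d = -1 ∨ d = 2 ∨ d = -2 → 2 ≤ (W₀.quadraticTwist (d : ℚ)).conductorExponent ((primesEquiv (R := ℤ)).symm ⟨2, Nat.prime_two⟩)) ∧
        modularSymbol D₀.f 0 ∉ periodLattice D₀.f ∧ periodLatticeGamma1 D₀.f ≠ periodLattice D₀.f) →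
      KatoFactTwoAt V D₁.f)
    :
    mazur_not_dvd_maninConstant_of_odd → abbesUllmo_not_dvd_maninConstant_of_not_dvd_level →
      cesnavicius_not_two_dvd_maninConstant_of_two_dvd_level → exists_isNewformOf →
      ∀ (W : WeierstrassCurve ℚ) [W.IsElliptic] [W.IsGloballyMinimal] {N : ℕ} [NeZero N] (D : ModularParametrizationData W N),
        (∀ z ∈ D.L.lattice, ∃ w ∈ periodLattice D.f, z = D.c * w) → 2 ^ 4 ∣ N →
        ((primesEquiv (R := 𝓞 ℚ)).symm ⟨2, Nat.prime_two⟩).valuation ℚ W.j < 1 →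
        (∀ d : ℤ, d = -1 ∨ d = 2 ∨ d = -2 → 2 ≤ (W.quadraticTwist (d : ℚ)).conductorExponent ((primesEquiv (R := ℤ)).symm ⟨2, Nat.prime_two⟩)) →
        ¬ (2 : ℤ) ∣ D.maninConstant := by
  intro _hMz _hAU _hCs _hnf W _ _ N _ D hopt h16 hss hcore
  have h4 : 2 ^ 2 ∣ N := dvd_trans ⟨4, by norm_num⟩ h16
  exact not_two_dvd_maninConstant_of_transferLawG_core hF hFstar hFnat hex h4
    (fun V _ _ D' hopt' e he h2 => hEven V D' h16 hopt' e he h2)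
    (fun V _ _ D' hopt' e e' he he' hne hidx => hTwoRoots V D' h16 hopt' e e' he he' hne hidx)
    (fun V₁ V _ _ _ _ D₁ D' hiso hD₁ hopt' hssV hcV h0 hΛ h1 h3 => h151 V₁ V D₁ D' hiso hD₁ h16 hopt' hssV hcV h0 hΛ h1 h3)
    (fun V _ _ D₁ hD₁ hguard =>
      katoFactTwoAt_of_symbolClosure_of_periodRecut hK h4 V D₁ (fun hno => h110 V D₁ hD₁ h16 hno hguard)) W D hopt hss hcore

/-- **THE ROUTE DECL `Theses.ManinLocalTwoThree.ManinOddAtFour` from the abstract v28 inputs** (§2, the binder-preserving rotation of `…SixteenSplitCore` and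
p2's `maninOddAtFour_of_core`).  CONDITIONAL reduction; C2, Manin's conjecture and BSD are NOT proved. [cite: Stevens1989, §2] [cite: Kato2004Asterisque, Thm. 12.5 (1) (p. 221)] -/
theorem maninOddAtFour_of_katoFact_udcTwo_transferLawG
    (hF : kato_neron_isIntegral_twistedSymbolSum_of_additive_two_real)
    (hFstar : optimalGamma1Parametrization_cusp_rational) (hFnat : optimalGamma1Parametrization_cuspZero_galoisConjugate)
    (hex : exists_optimal_gamma1ParametrizationData) (hK : kato_isIntegral_twistedSymbolSum_two_symbolClosure)
    (hEven : ∀ (W : WeierstrassCurve ℚ) [W.IsElliptic] [W.IsGloballyMinimal] {N : ℕ} [NeZero N] (D : ModularParametrizationData W N),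
      2 ^ 4 ∣ N → (∀ z ∈ D.L.lattice, ∃ w ∈ periodLattice D.f, z = D.c * w) →
      ∀ e : ℚ, W.twoTorsionPolynomial.toPoly.IsRoot e → (2 : ℤ) ∣ D.c → periodLatticeGamma1 D.f ≠ periodLattice D.f)
    (hTwoRoots : ∀ (W : WeierstrassCurve ℚ) [W.IsElliptic] [W.IsGloballyMinimal] {N : ℕ} [NeZero N] (D : ModularParametrizationData W N),
      2 ^ 4 ∣ N → (∀ z ∈ D.L.lattice, ∃ w ∈ periodLattice D.f, z = D.c * w) →
      ∀ e e' : ℚ, W.twoTorsionPolynomial.toPoly.IsRoot e → W.twoTorsionPolynomial.toPoly.IsRoot e' → e ≠ e' →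
      ¬ (∀ z : ℂ, z ∈ periodLatticeGamma1 D.f ↔ ∃ w ∈ periodLattice D.f, z = 2 * w) → ¬ (2 : ℤ) ∣ D.maninConstant)
    (h151 : ∀ (W₁ W : WeierstrassCurve ℚ) [W₁.IsElliptic] [W₁.IsGloballyMinimal] [W.IsElliptic] [W.IsGloballyMinimal] {N : ℕ} [NeZero N]
      (D₁ : Gamma1ParametrizationData W₁ N) (D : ModularParametrizationData W N), IsIsogenous W₁ W → D₁.IsOptimal →
      2 ^ 4 ∣ N → (∀ z ∈ D.L.lattice, ∃ w ∈ periodLattice D.f, z = D.c * w) →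
      ((primesEquiv (R := 𝓞 ℚ)).symm ⟨2, Nat.prime_two⟩).valuation ℚ W.j < 1 →
      (∀ d : ℤ, d = -1 ∨ d = 2 ∨ d = -2 → 2 ≤ (W.quadraticTwist (d : ℚ)).conductorExponent ((primesEquiv (R := ℤ)).symm ⟨2, Nat.prime_two⟩)) →
      modularSymbol D.f 0 ∉ periodLattice D.f → periodLatticeGamma1 D.f ≠ periodLattice D.f → W.a₁ = 0 → W.a₃ = 0 →
      D.maninConstant.natAbs = D₁.maninConstant.natAbs)
    (h110 : ∀ (V : WeierstrassCurve ℚ) [V.IsElliptic] [V.IsGloballyMinimal] {N : ℕ} [NeZero N]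
      (D₁ : Gamma1ParametrizationData V N), D₁.IsOptimal → 2 ^ 4 ∣ N →
      (¬ ∃ (V' : WeierstrassCurve ℚ) (_ : V'.IsElliptic) (_ : V'.IsGloballyMinimal) (q m : ℤ),
        Odd q ∧ WeierstrassCurve.IsIsogenous V' V ∧ (q : ℝ) * V'.realPeriodRat = (m : ℝ) * V.realPeriodRat ∧
        IsSymbolClosureCurve V' D₁.f) →
      (∃ (W₀ : WeierstrassCurve ℚ) (_ : W₀.IsElliptic) (_ : W₀.IsGloballyMinimal) (D₀ : ModularParametrizationData W₀ N),
        IsIsogenous V W₀ ∧ (∀ z ∈ D₀.L.lattice, ∃ w ∈ periodLattice D₀.f, z = D₀.c * w) ∧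
        W₀.a₁ = 0 ∧ W₀.a₃ = 0 ∧ HasRationalTwoTorsion W₀ ∧ AllRationalTwoTorsionBlind W₀ ∧
        ((primesEquiv (R := 𝓞 ℚ)).symm ⟨2, Nat.prime_two⟩).valuation ℚ W₀.j < 1 ∧
        (∀ d : ℤ, d = -1 ∨ d = 2 ∨ d = -2 → 2 ≤ (W₀.quadraticTwist (d : ℚ)).conductorExponent ((primesEquiv (R := ℤ)).symm ⟨2, Nat.prime_two⟩)) ∧
        modularSymbol D₀.f 0 ∉ periodLattice D₀.f ∧ periodLatticeGamma1 D₀.f ≠ periodLattice D₀.f) →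
      KatoFactTwoAt V D₁.f)
    : Summit.BirchSwinnertonDyer.BirchSwinnertonDyer.Theses.ManinLocalTwoThree.ManinOddAtFour :=
  maninOddAtFour_of_core
    (maninOddAtFourCore_of_maninOddAtSixteenCore
      (maninOddAtSixteenCore_of_v28 hF hFstar hFnat hex hK hEven hTwoRoots h151 h110))

/-! ## §3 The instantiations: UDC₂ = p2's AN2₂ theorem + CDT; the row inline or by -an's name -/

/-- **THE ROUTE DECL BY NAME from the v28-candidate inputs**: F♯, F★, F♮, CES, F-es-21♭K, CDT-algInt (PRINTED) and the OPEN rows {E-an-151|_G, 6♭‴|_G} stated INLINE (the v28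
skeleton's stubs).  CONDITIONAL reduction; C2, Manin's conjecture and BSD are NOT proved. [cite: CalegariDimitrovTang2025, Thm. 1.0.1 and Remarks 58–59] [cite: KurthLong2008, Prop. 18]
[cite: Stevens1989, §2] [cite: CesnaviciusNeururerSaha2023, Lemma 6.5] -/
theorem maninOddAtFour_of_katoFact_CDT_transferLawG
    (hF : kato_neron_isIntegral_twistedSymbolSum_of_additive_two_real)
    (hFstar : optimalGamma1Parametrization_cusp_rational) (hFnat : optimalGamma1Parametrization_cuspZero_galoisConjugate)
    (hex : exists_optimal_gamma1ParametrizationData) (hK : kato_isIntegral_twistedSymbolSum_two_symbolClosure)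
    (hCDT : Literature.NumberTheory.Automorphic.CalegariDimitrovTang2025_unboundedDenominators_algInt)
    (h151 : ∀ (W₁ W : WeierstrassCurve ℚ) [W₁.IsElliptic] [W₁.IsGloballyMinimal] [W.IsElliptic] [W.IsGloballyMinimal] {N : ℕ} [NeZero N]
      (D₁ : Gamma1ParametrizationData W₁ N) (D : ModularParametrizationData W N), IsIsogenous W₁ W → D₁.IsOptimal →
      2 ^ 4 ∣ N → (∀ z ∈ D.L.lattice, ∃ w ∈ periodLattice D.f, z = D.c * w) →
      ((primesEquiv (R := 𝓞 ℚ)).symm ⟨2, Nat.prime_two⟩).valuation ℚ W.j < 1 →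
      (∀ d : ℤ, d = -1 ∨ d = 2 ∨ d = -2 → 2 ≤ (W.quadraticTwist (d : ℚ)).conductorExponent ((primesEquiv (R := ℤ)).symm ⟨2, Nat.prime_two⟩)) →
      modularSymbol D.f 0 ∉ periodLattice D.f → periodLatticeGamma1 D.f ≠ periodLattice D.f → W.a₁ = 0 → W.a₃ = 0 →
      D.maninConstant.natAbs = D₁.maninConstant.natAbs)
    (h110 : ∀ (V : WeierstrassCurve ℚ) [V.IsElliptic] [V.IsGloballyMinimal] {N : ℕ} [NeZero N]
      (D₁ : Gamma1ParametrizationData V N), D₁.IsOptimal → 2 ^ 4 ∣ N →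
      (¬ ∃ (V' : WeierstrassCurve ℚ) (_ : V'.IsElliptic) (_ : V'.IsGloballyMinimal) (q m : ℤ),
        Odd q ∧ WeierstrassCurve.IsIsogenous V' V ∧ (q : ℝ) * V'.realPeriodRat = (m : ℝ) * V.realPeriodRat ∧
        IsSymbolClosureCurve V' D₁.f) →
      (∃ (W₀ : WeierstrassCurve ℚ) (_ : W₀.IsElliptic) (_ : W₀.IsGloballyMinimal) (D₀ : ModularParametrizationData W₀ N),
        IsIsogenous V W₀ ∧ (∀ z ∈ D₀.L.lattice, ∃ w ∈ periodLattice D₀.f, z = D₀.c * w) ∧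
        W₀.a₁ = 0 ∧ W₀.a₃ = 0 ∧ HasRationalTwoTorsion W₀ ∧ AllRationalTwoTorsionBlind W₀ ∧
        ((primesEquiv (R := 𝓞 ℚ)).symm ⟨2, Nat.prime_two⟩).valuation ℚ W₀.j < 1 ∧
        (∀ d : ℤ, d = -1 ∨ d = 2 ∨ d = -2 → 2 ≤ (W₀.quadraticTwist (d : ℚ)).conductorExponent ((primesEquiv (R := ℤ)).symm ⟨2, Nat.prime_two⟩)) ∧
        modularSymbol D₀.f 0 ∉ periodLattice D₀.f ∧ periodLatticeGamma1 D₀.f ≠ periodLattice D₀.f) →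
      KatoFactTwoAt V D₁.f)
    : Summit.BirchSwinnertonDyer.BirchSwinnertonDyer.Theses.ManinLocalTwoThree.ManinOddAtFour :=
  maninOddAtFour_of_katoFact_udcTwo_transferLawG hF hFstar hFnat hex hK
    (fun W _ _ N _ D h16 hopt e he h2 ↦
      UDCTwo.periodLatticeGamma1_ne_of_two_dvd_of_CDT_algInt hCDT W D (dvd_trans ⟨4, by norm_num⟩ h16) hopt he h2)
    (fun W _ _ N _ D h16 hopt e e' he he' hne hidx ↦
      FullTwoTorsion.not_two_dvd_maninConstant_of_two_roots_of_not_indexFour UDCTwo.sqRootWitnessLaw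
        (fun k ↦ UDWOfCDT.unboundedDenominatorsWeightAlgInt_of_CDT_algInt hCDT k) D (dvd_trans ⟨4, by norm_num⟩ h16) hopt he he' hne hidx)
    h151 h110

/-- **THE ROUTE DECL BY NAME from -an's NAMED row E-an-151 `ShimuraKernel.GammaOneTransferAtFour`** (stronger than the G-form consumed) + 6♭‴|_G inline + the printed facts + CDT.
CONDITIONAL reduction; C2, Manin's conjecture and BSD are NOT proved. [cite: Stevens1989, §2] [cite: CesnaviciusNeururerSaha2023, Lemma 6.5] -/
theorem maninOddAtFour_of_katoFact_CDT_transferRow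
    (hF : kato_neron_isIntegral_twistedSymbolSum_of_additive_two_real)
    (hFstar : optimalGamma1Parametrization_cusp_rational) (hFnat : optimalGamma1Parametrization_cuspZero_galoisConjugate)
    (hex : exists_optimal_gamma1ParametrizationData) (hK : kato_isIntegral_twistedSymbolSum_two_symbolClosure)
    (hCDT : Literature.NumberTheory.Automorphic.CalegariDimitrovTang2025_unboundedDenominators_algInt)
    (h151 : GammaOneTransferAtFour)
    (h110 : ∀ (V : WeierstrassCurve ℚ) [V.IsElliptic] [V.IsGloballyMinimal] {N : ℕ} [NeZero N]
      (D₁ : Gamma1ParametrizationData V N), D₁.IsOptimal → 2 ^ 4 ∣ N →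
      (¬ ∃ (V' : WeierstrassCurve ℚ) (_ : V'.IsElliptic) (_ : V'.IsGloballyMinimal) (q m : ℤ),
        Odd q ∧ WeierstrassCurve.IsIsogenous V' V ∧ (q : ℝ) * V'.realPeriodRat = (m : ℝ) * V.realPeriodRat ∧
        IsSymbolClosureCurve V' D₁.f) →
      (∃ (W₀ : WeierstrassCurve ℚ) (_ : W₀.IsElliptic) (_ : W₀.IsGloballyMinimal) (D₀ : ModularParametrizationData W₀ N),
        IsIsogenous V W₀ ∧ (∀ z ∈ D₀.L.lattice, ∃ w ∈ periodLattice D₀.f, z = D₀.c * w) ∧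
        W₀.a₁ = 0 ∧ W₀.a₃ = 0 ∧ HasRationalTwoTorsion W₀ ∧ AllRationalTwoTorsionBlind W₀ ∧
        ((primesEquiv (R := 𝓞 ℚ)).symm ⟨2, Nat.prime_two⟩).valuation ℚ W₀.j < 1 ∧
        (∀ d : ℤ, d = -1 ∨ d = 2 ∨ d = -2 → 2 ≤ (W₀.quadraticTwist (d : ℚ)).conductorExponent ((primesEquiv (R := ℤ)).symm ⟨2, Nat.prime_two⟩)) ∧
        modularSymbol D₀.f 0 ∉ periodLattice D₀.f ∧ periodLatticeGamma1 D₀.f ≠ periodLattice D₀.f) →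
      KatoFactTwoAt V D₁.f)
    : Summit.BirchSwinnertonDyer.BirchSwinnertonDyer.Theses.ManinLocalTwoThree.ManinOddAtFour :=
  maninOddAtFour_of_katoFact_CDT_transferLawG hF hFstar hFnat hex hK hCDT
    (fun W₁ W _ _ _ _ _N _ D₁ D hiso hD₁ h16 hopt _hss _hcore _h0 _hΛ _h1 _h3 ↦ h151 W₁ W D₁ D hiso hD₁ hopt (dvd_trans ⟨4, by norm_num⟩ h16))
    h110

end Summit.BirchSwinnertonDyer.BirchSwinnertonDyer.Theorems.ManinLocalTwoThree.TransferSplit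

end
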